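import Summits.BirchSwinnertonDyer.BirchSwinnertonDyer.Theses.SignedLowerHalves
import Summits.BirchSwinnertonDyer.BirchSwinnertonDyer.Theorems.KimAtThreeKolyvaginCertificateDictionary
import Summits.BirchSwinnertonDyer.Rank1Residual.Supersingular.KobayashiMainConjecture
import Summits.BirchSwinnertonDyer.Rank1Residual.X4.KimTamagawaDefect
import Literature.NumberTheory.EllipticCurves.Rank1Residual.Typed.X7
import HarnessLib

/-!
# Crux `KobayashiLowerHalfLargeImage` (route `SignedLowerHalves`, item stmt-BirchSwinnertonDyer-19001), line
# `kurihara_rigidity` (skeleton `Cruxes/KobayashiLowerHalfLargeImage/Lines/kurihara_rigidity.lean`, reshape r2):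
# the COMPOSITION kernel-checked BY NAME against the tree's typed conjecture items — the crux follows from the
# two engines, the two halves of Kim's Conjecture 1.10 (`X4.KimTamagawaDefectLeAt` / `…GeAt`) on the large-image
# corner of X7, and the `p = 3` residue — and the `≤` half made Σ⁰₁ per pair (one explicit Kurihara number)
# (cell `bsd-ssimc`, seat `bsd-line-slh-p1`, lead of the line)

HONEST FRAMING (D-0152): theorems only (no definition, no named fact, no `sorry`, axioms standard); every
theorem is CONDITIONAL on displayed hypotheses and closes nothing; the crux stays OPEN; BSD is not proved by any
of this. What the file buys: (1) the line's reduction is no longer a workfile claim but a kernel theorem whose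
hypotheses are NAMED tree objects — `kobayashiLowerHalfLargeImage_of_engines_of_kimTamagawaDefect`: the crux BY
NAME from the statements of ENGINE A (Kim 1.11 ∘ Kobayashi 7.4, regime `p ∤ ∏ c_ℓ`) and ENGINE B (Castella–Sano
Thm 1 ∘ Kobayashi 7.4), both closed modulo their binders in
`Rank1Residual/Supersingular/KobayashiMainConjectureKuriharaRigidity.lean`, plus `X4.KimTamagawaDefectLeAt W p f`
and `X4.KimTamagawaDefectGeAt W p f` for the newform of every X7 ∧ ¬CM ∧ `a_p = 0` ∧ Surj pair at `p ≥ 5`, plus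
the crux's own conclusion at `p = 3`; (2) on the `p ∤ ∏ c_ℓ` rows the `≥` half and the preprint engine drop
out: `X7.kobayashiMainConjecture_of_engineA_of_kimTamagawaDefectLe` (both signs from ENGINE A's statement and
the `≤` half alone); (3) the `≤` half AT A PAIR is equivalent to the existence of ONE certificate — a cyclic
Kolyvagin level `n ∈ 𝒩_k`, `1 ≤ k ≤ ord_p ∏ c_ℓ + 1`, surjective discrete logarithms `ψ`, and
`kuriharaNumber f (p^k) n ψ ≠ 0` (`kimTamagawaDefectLeAt_iff_exists_certificate`), i.e. the hard stub of the
line is a per-pair DECIDABLE non-vanishing statement (what kit j296231 certified on 77 X7 pairs).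

References: [Kim2022StructureSelmer] Thm 1.11, Conj 1.10, §1.5.1; [CastellaSano2026] Thm 1 (PRE); [Kobayashi2003]
Thm 7.4, Conjecture (p. 2); [Buyukboduk2009TamagawaDefect] Thm B (why the `≥` half is its own hypothesis).
-/

set_option autoImplicit false
-- the Theorems namespace of a single-conjunct summit repeats the summit name by design (D-0017)
set_option linter.dupNamespace false

noncomputable section

open scoped Classical MatrixGroups ModularForm

open CongruenceSubgroup WeierstrassCurve Literature.NumberTheory.EllipticCurves
  Literature.NumberTheory.EllipticCurves.ModularForms
  Literature.NumberTheory.EllipticCurves.Rank1Residual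
  Literature.NumberTheory.EllipticCurves.Rank1Residual.Typed
  Summit.BirchSwinnertonDyer.Rank1Residual.Supersingular
  Summit.BirchSwinnertonDyer.Rank1Residual.X4
  Summit.BirchSwinnertonDyer.BirchSwinnertonDyer.Theorems.KimAtThreeKolyvaginCertificateDictionary

namespace Summit.BirchSwinnertonDyer.BirchSwinnertonDyer.Theorems.KuriharaRigidity

/-! ### §1 The `≤` half at a pair is ONE certificate (Σ⁰₁) -/

section Certificate

variable (W : WeierstrassCurve ℚ) [W.IsGloballyMinimal] (p : ℕ) {N : ℕ} (f : CuspForm (Gamma0 N) 2)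

/-- **One explicit Kurihara number certifies the `≤` half**: a cyclic Kolyvagin level `n ∈ 𝒩_k(W,p)` with
`k ≤ τ + 1`, surjective discrete logarithms `ψ` and `kuriharaNumber f (p^k) n ψ ≠ 0` give
`∂^{(∞)}(δ̃) ≤ τ` (`∂^{(∞)} ≤ ∂^{(ν(n))} ≤ ord δ̃_n ≤ k − 1 ≤ τ`).
[cite: Kim2022StructureSelmer, §1.5.1 (PDF p. 7), Def. 2.13 (PDF p. 14)] -/
theorem kuriharaPartialInfty_le_of_certificate {τ n k : ℕ} (hn : IsCyclicKolyvaginLevel W p n)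
    (hk : Kato.IsKolyvaginProduct W p k n) (hkτ : k ≤ τ + 1)
    (ψ : (ℓ : ℕ) → (ZMod ℓ)ˣ →* Multiplicative (ZMod (p ^ k)))
    (hψ : ∀ ℓ ∈ n.primeFactors, Function.Surjective (ψ ℓ))
    (hne : haveI : NeZero n := ⟨hk.ne_zero⟩; kuriharaNumber f (p ^ k) n ψ ≠ 0) :
    kuriharaPartialInfty W p f ≤ (τ : ℕ∞) := by
  haveI : NeZero n := ⟨hk.ne_zero⟩
  have hndiv : ¬ KuriharaDivisibleAt W p f n (τ + 1) :=
    not_kuriharaDivisibleAt_of_kuriharaNumber_ne_zero W p f hkτ hk ψ hψ hne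
  exact (kuriharaPartialInfty_le W p f _).trans
    ((kuriharaPartial_le W p f hn rfl).trans ((kuriharaDivIndex_le_coe_iff W p f n τ).mpr hndiv))

/-- **The `≤` half of Kim's Conjecture 1.10 at `(W, p, f)` is Σ⁰₁**: `X4.KimTamagawaDefectLeAt W p f` holds iff
SOME cyclic Kolyvagin level `n ∈ 𝒩_k`, `1 ≤ k ≤ ord_p ∏ c_ℓ + 1`, carries a Kurihara number
`kuriharaNumber f (p^k) n ψ ≠ 0` for some surjective discrete logarithms `ψ` — one finite exact computation per
pair (the hard stub `stub_kuriharaPartialInfty_le_tamagawa_X7` of line `kurihara_rigidity` asserts this for every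
pair of the large-image corner of X7). [cite: Kim2022StructureSelmer, Conj. 1.10 (PDF p. 8), §1.5.1 (PDF p. 7)] -/
theorem kimTamagawaDefectLeAt_iff_exists_certificate :
    KimTamagawaDefectLeAt W p f ↔
      ∃ (n k : ℕ) (hk : Kato.IsKolyvaginProduct W p k n), IsCyclicKolyvaginLevel W p n ∧
        1 ≤ k ∧ k ≤ padicValNat p W.tamagawaProduct + 1 ∧
        ∃ ψ : (ℓ : ℕ) → (ZMod ℓ)ˣ →* Multiplicative (ZMod (p ^ k)),
          (∀ ℓ ∈ n.primeFactors, Function.Surjective (ψ ℓ)) ∧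
          (haveI : NeZero n := ⟨hk.ne_zero⟩; kuriharaNumber f (p ^ k) n ψ ≠ 0) :=
  ⟨exists_certificate_of_kuriharaPartialInfty_le W p f,
    fun ⟨_, _, hk, hn, _, hkτ, ψ, hψ, hne⟩ =>
      kuriharaPartialInfty_le_of_certificate W p f hn hk hkτ ψ hψ hne⟩

end Certificate

/-! ### §2 The composition BY NAME against the typed conjecture items -/

section Composition

/-- **ENGINE A's statement** (the registered stub `stub_signedMC_of_kuriharaPartialInfty_eq_zero`, verbatim):
regime `p ∤ ∏ c_ℓ`, `∂^{(∞)}(δ̃) = 0` for every newform ⟹ both signed main conjectures. Closed modulo the binder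
`Kim2026_thm111_via_kobayashi74` (Kim AJM 2026 Thm 1.11 (1)⇒(3) ∘ Kobayashi 2003 Thm 7.4, both PUBLISHED) and the
period fact `realPeriodRat_eq_unit_mul_plusPeriod`. An abbreviation for statements (a `Prop`, nothing asserted).
[cite: Kim2022StructureSelmer, Thm. 1.11 (1) ⟹ (3)] [cite: Kobayashi2003, Thm. 7.4 (p. 13)] -/
theorem engineA_iff_kuriharaUnitAt : (∀ (W : WeierstrassCurve ℚ) [W.IsElliptic] [W.IsGloballyMinimal] (p : ℕ) [Fact p.Prime],
      5 ≤ p → W.HasGoodReductionAtPrime p → W.frobeniusTrace p = 0 → Surj W p →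
      ¬ p ∣ W.tamagawaProduct →
      (∀ [NeZero (W.conductorNorm ℤ)] (f : CuspForm (Gamma0 (W.conductorNorm ℤ)) 2),
          IsNewformOf W f → kuriharaPartialInfty W p f = 0) →
      ∀ ε : ℤˣ, KobayashiMainConjecture W p ε) ↔
    (∀ (W : WeierstrassCurve ℚ) [W.IsElliptic] [W.IsGloballyMinimal] (p : ℕ) [Fact p.Prime],
      5 ≤ p → W.HasGoodReductionAtPrime p → W.frobeniusTrace p = 0 → Surj W p →
      ¬ p ∣ W.tamagawaProduct →
      (∀ [NeZero (W.conductorNorm ℤ)] (f : CuspForm (Gamma0 (W.conductorNorm ℤ)) 2),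
          IsNewformOf W f → KuriharaUnitAt W p f) →
      ∀ ε : ℤˣ, KobayashiMainConjecture W p ε) := by
  constructor
  · intro h W _ _ p _ hp5 hgood hap hs htam hcert
    exact h W p hp5 hgood hap hs htam
      fun f hf => (kuriharaUnitAt_iff_kuriharaPartialInfty_eq_zero W p f).mp (hcert f hf)
  · intro h W _ _ p _ hp5 hgood hap hs htam hcert
    exact h W p hp5 hgood hap hs htam
      fun f hf => (kuriharaUnitAt_iff_kuriharaPartialInfty_eq_zero W p f).mpr (hcert f hf)

/-- **THE LINE'S REDUCTION, BY NAME.** The crux `KobayashiLowerHalfLargeImage` follows from: (A) ENGINE A's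
statement (`p ∤ ∏ c_ℓ`; Kim 1.11 ∘ Kobayashi 7.4, published); (B) ENGINE B's statement (Castella–Sano Thm 1 ∘
Kobayashi 7.4, preprint binder); (Le) the `≤` half `X4.KimTamagawaDefectLeAt W p f` and (Ge) the `≥` half
`X4.KimTamagawaDefectGeAt W p f` of Kim's Conjecture 1.10 for every newform `f` of every pair of the large-image
corner of X7 at `p ≥ 5` (X7, non-CM, `a_p = 0`, `ρ̄` onto); (3) the crux's conclusion at `p = 3`. Proof: an odd
prime is `3` or `≥ 5`; the two halves give `∂^{(∞)}(δ̃) = ord_p ∏ c_ℓ` (`kimTamagawaDefectAt_iff`); if `p ∤ ∏ c_ℓ`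
this reads `∂^{(∞)} = 0` and (A) applies, else (B); either gives the main conjecture for every sign, whence the
Eisenstein half for `ε = 1` (`kobayashiLowerDivisibility_of_mainConjecture`). CONDITIONAL; closes nothing.
[cite: Kim2022StructureSelmer, Thm. 1.11 and Conj. 1.10 (PDF p. 8)] [cite: Kobayashi2003, Thm. 7.4 (p. 13) and Conjecture (p. 2)]
[claim: CastellaSano2026, status: under-review] -/
theorem kobayashiLowerHalfLargeImage_of_engines_of_kimTamagawaDefect
    (hA : ∀ (W : WeierstrassCurve ℚ) [W.IsElliptic] [W.IsGloballyMinimal] (p : ℕ) [Fact p.Prime],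
      5 ≤ p → W.HasGoodReductionAtPrime p → W.frobeniusTrace p = 0 → Surj W p →
      ¬ p ∣ W.tamagawaProduct →
      (∀ [NeZero (W.conductorNorm ℤ)] (f : CuspForm (Gamma0 (W.conductorNorm ℤ)) 2),
          IsNewformOf W f → kuriharaPartialInfty W p f = 0) →
      ∀ ε : ℤˣ, KobayashiMainConjecture W p ε)
    (hB : ∀ (W : WeierstrassCurve ℚ) [W.IsElliptic] [W.IsGloballyMinimal] (p : ℕ) [Fact p.Prime],
      5 ≤ p → W.HasGoodReductionAtPrime p → W.frobeniusTrace p = 0 → ¬ W.HasCM → Surj W p →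
      (∀ [NeZero (W.conductorNorm ℤ)] (f : CuspForm (Gamma0 (W.conductorNorm ℤ)) 2),
          IsNewformOf W f →
            kuriharaPartialInfty W p f = (padicValNat p W.tamagawaProduct : ℕ∞)) →
      ∀ ε : ℤˣ, KobayashiMainConjecture W p ε)
    (hLe : ∀ (W : WeierstrassCurve ℚ) [W.IsElliptic] [W.IsGloballyMinimal] (p : ℕ) [Fact p.Prime],
      5 ≤ p → ClassX7 W p → ¬ W.HasCM → W.frobeniusTrace p = 0 → Surj W p →
      ∀ [NeZero (W.conductorNorm ℤ)] (f : CuspForm (Gamma0 (W.conductorNorm ℤ)) 2),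
        IsNewformOf W f → KimTamagawaDefectLeAt W p f)
    (hGe : ∀ (W : WeierstrassCurve ℚ) [W.IsElliptic] [W.IsGloballyMinimal] (p : ℕ) [Fact p.Prime],
      5 ≤ p → ClassX7 W p → ¬ W.HasCM → W.frobeniusTrace p = 0 → Surj W p →
      ∀ [NeZero (W.conductorNorm ℤ)] (f : CuspForm (Gamma0 (W.conductorNorm ℤ)) 2),
        IsNewformOf W f → KimTamagawaDefectGeAt W p f)
    (h3 : ∀ (W : WeierstrassCurve ℚ) [W.IsElliptic] [W.IsGloballyMinimal] (p : ℕ) [Fact p.Prime],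
      p = 3 → ClassX7 W p → ¬ W.HasCM → W.frobeniusTrace p = 0 → Surj W p →
      ∃ ε : ℤˣ, KobayashiLowerDivisibility W p ε) :
    Summit.BirchSwinnertonDyer.BirchSwinnertonDyer.Theses.SignedLowerHalves.KobayashiLowerHalfLargeImage := by
  intro W _ _ p _ hp2 hX hcm hap hs
  have hpP : p.Prime := Fact.out
  by_cases hp5 : 5 ≤ p
  · have heq : ∀ [NeZero (W.conductorNorm ℤ)] (f : CuspForm (Gamma0 (W.conductorNorm ℤ)) 2),
        IsNewformOf W f → KimTamagawaDefectAt W p f :=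
      fun f hf => (kimTamagawaDefectAt_iff W p f).mpr
        ⟨hLe W p hp5 hX hcm hap hs f hf, hGe W p hp5 hX hcm hap hs f hf⟩
    by_cases htam : p ∣ W.tamagawaProduct
    · exact ⟨1, kobayashiLowerDivisibility_of_mainConjecture
        (hB W p hp5 hX.1.1 hap hcm hs (fun f hf => heq f hf) 1)⟩
    · refine ⟨1, kobayashiLowerDivisibility_of_mainConjecture
        (hA W p hp5 hX.1.1 hap hs htam (fun f hf => ?_) 1)⟩
      have h := heq f hf
      rw [KimTamagawaDefectAt, padicValNat.eq_zero_of_not_dvd htam, Nat.cast_zero] at h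
      exact h
  · have hp3 : p = 3 := by
      have h2 := hpP.two_le
      interval_cases p
      · exact absurd rfl hp2
      · rfl
      · exact absurd hpP (by decide)
    exact h3 W p hp3 hX hcm hap hs

variable (W : WeierstrassCurve ℚ) [W.IsElliptic] [W.IsGloballyMinimal] (p : ℕ) [Fact p.Prime]

/-- **On the `p ∤ ∏ c_ℓ` rows of the large-image corner of X7 the preprint engine and the `≥` half drop out**:
both signed main conjectures at the pair follow from ENGINE A's statement (published inputs) and the `≤` half
`X4.KimTamagawaDefectLeAt W p f` for the newforms of `W` (there `≤ 0`, i.e. a unit Kurihara number at a cyclic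
level, `kimTamagawaDefectLeAt_iff_kuriharaUnitAt_of_not_dvd`). Good reduction from `ClassX7`. CONDITIONAL.
[cite: Kim2022StructureSelmer, Thm. 1.11 (1) ⟹ (3) and Conj. 1.10] [cite: Kobayashi2003, Thm. 7.4 (p. 13)] -/
theorem X7.kobayashiMainConjecture_of_engineA_of_kimTamagawaDefectLe
    (hA : ∀ (W : WeierstrassCurve ℚ) [W.IsElliptic] [W.IsGloballyMinimal] (p : ℕ) [Fact p.Prime],
      5 ≤ p → W.HasGoodReductionAtPrime p → W.frobeniusTrace p = 0 → Surj W p →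
      ¬ p ∣ W.tamagawaProduct →
      (∀ [NeZero (W.conductorNorm ℤ)] (f : CuspForm (Gamma0 (W.conductorNorm ℤ)) 2),
          IsNewformOf W f → kuriharaPartialInfty W p f = 0) →
      ∀ ε : ℤˣ, KobayashiMainConjecture W p ε)
    (hp5 : 5 ≤ p) (hX : ClassX7 W p) (hap : W.frobeniusTrace p = 0) (hs : Surj W p)
    (htam : ¬ p ∣ W.tamagawaProduct)
    (hLe : ∀ [NeZero (W.conductorNorm ℤ)] (f : CuspForm (Gamma0 (W.conductorNorm ℤ)) 2),
      IsNewformOf W f → KimTamagawaDefectLeAt W p f) (ε : ℤˣ) :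
    KobayashiMainConjecture W p ε := by
  refine hA W p hp5 hX.1.1 hap hs htam (fun f hf => ?_) ε
  have h := hLe f hf
  rw [KimTamagawaDefectLeAt, padicValNat.eq_zero_of_not_dvd htam, Nat.cast_zero] at h
  exact nonpos_iff_eq_zero.mp h

/-- **… hence the crux's conclusion at such a pair** (the Eisenstein half for the sign `+1`), from ENGINE A's
statement and the `≤` half alone. CONDITIONAL; closes nothing.
[cite: Kim2022StructureSelmer, Thm. 1.11 (1) ⟹ (3) and Conj. 1.10] [cite: Kobayashi2003, Thm. 7.4 (p. 13) and Conjecture (p. 2)] -/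
theorem X7.kobayashiLowerDivisibility_of_engineA_of_kimTamagawaDefectLe
    (hA : ∀ (W : WeierstrassCurve ℚ) [W.IsElliptic] [W.IsGloballyMinimal] (p : ℕ) [Fact p.Prime],
      5 ≤ p → W.HasGoodReductionAtPrime p → W.frobeniusTrace p = 0 → Surj W p →
      ¬ p ∣ W.tamagawaProduct →
      (∀ [NeZero (W.conductorNorm ℤ)] (f : CuspForm (Gamma0 (W.conductorNorm ℤ)) 2),
          IsNewformOf W f → kuriharaPartialInfty W p f = 0) →
      ∀ ε : ℤˣ, KobayashiMainConjecture W p ε)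
    (hp5 : 5 ≤ p) (hX : ClassX7 W p) (hap : W.frobeniusTrace p = 0) (hs : Surj W p)
    (htam : ¬ p ∣ W.tamagawaProduct)
    (hLe : ∀ [NeZero (W.conductorNorm ℤ)] (f : CuspForm (Gamma0 (W.conductorNorm ℤ)) 2),
      IsNewformOf W f → KimTamagawaDefectLeAt W p f) :
    ∃ ε : ℤˣ, KobayashiLowerDivisibility W p ε :=
  ⟨1, kobayashiLowerDivisibility_of_mainConjecture
    (X7.kobayashiMainConjecture_of_engineA_of_kimTamagawaDefectLe W p hA hp5 hX hap hs htam hLe 1)⟩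

/-- **At a single pair, one UNIT Kurihara number suffices on the `p ∤ ∏ c_ℓ` rows**: for `W` good at `p ≥ 5` with
`a_p = 0`, `ρ̄` onto, `p ∤ ∏ c_ℓ`, ENGINE A's statement and `X4.KuriharaUnitAt W p f` for every newform `f` of
`W` (a cyclic `n ∈ 𝒩₁` with `kuriharaNumber f p n ψ ≠ 0`) give `KobayashiMainConjecture W p ε` for both signs —
the per-pair CERTIFICATE form of the line (kit j296231's controls 88a1, 112a1, 148a1 are of this shape).
CONDITIONAL. [cite: Kim2022StructureSelmer, Thm. 1.11 (1) ⟹ (3)] [cite: Kobayashi2003, Thm. 7.4 (p. 13)] -/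
theorem kobayashiMainConjecture_of_engineA_of_kuriharaUnitAt
    (hA : ∀ (W : WeierstrassCurve ℚ) [W.IsElliptic] [W.IsGloballyMinimal] (p : ℕ) [Fact p.Prime],
      5 ≤ p → W.HasGoodReductionAtPrime p → W.frobeniusTrace p = 0 → Surj W p →
      ¬ p ∣ W.tamagawaProduct →
      (∀ [NeZero (W.conductorNorm ℤ)] (f : CuspForm (Gamma0 (W.conductorNorm ℤ)) 2),
          IsNewformOf W f → kuriharaPartialInfty W p f = 0) →
      ∀ ε : ℤˣ, KobayashiMainConjecture W p ε)
    (hp5 : 5 ≤ p) (hgood : W.HasGoodReductionAtPrime p) (hap : W.frobeniusTrace p = 0) (hs : Surj W p)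
    (htam : ¬ p ∣ W.tamagawaProduct)
    (hunit : ∀ [NeZero (W.conductorNorm ℤ)] (f : CuspForm (Gamma0 (W.conductorNorm ℤ)) 2),
      IsNewformOf W f → KuriharaUnitAt W p f) (ε : ℤˣ) :
    KobayashiMainConjecture W p ε :=
  hA W p hp5 hgood hap hs htam
    (fun f hf => (kuriharaUnitAt_iff_kuriharaPartialInfty_eq_zero W p f).mp (hunit f hf)) ε

end Composition

end Summit.BirchSwinnertonDyer.BirchSwinnertonDyer.Theorems.KuriharaRigidity

end
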